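import Summits.BirchSwinnertonDyer.BirchSwinnertonDyer.Theorems.SmallImageMuTransferMuTransferX9KolyvaginClassTwistRat
import Summits.BirchSwinnertonDyer.BirchSwinnertonDyer.Theorems.SmallImageMuTransferMuTransferX9KolyvaginClassTwistLocal
import Summits.BirchSwinnertonDyer.BirchSwinnertonDyer.Theorems.SmallImageMuTransferMuTransferX9KolyvaginClassTwistUnramified
import HarnessLib

/-!
# K6 crux `MuTransferX9` (stmt-BirchSwinnertonDyer-19276), skeleton v6 stub `stub_stepsTwoFourOdd`:
# the Kolyvagin cocycle `c = Φ` over `ℚ` IN THE SHAPE OF THE G3/G4 MEETING POINT — `c`, `hx`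
# (`loc_v [c] ∈ H¹_ur`, `v ∉ S`, `v ≠ q`), `loc_q [c] ∈ H¹_tr`, and a local inertia element `τq`
# with `c (res τq) = Φ(σ) = −a` (x10 p454438 `StepFour.convCoeff_eq_zero_of_qTermIdentity`)

Cell `bsd-smallim`, seat `bsd-smallim-k6-g3` (gen 0).  THEOREMS ONLY; assembly of my four files
(p451028 generic Lemma 2, p454778 ℚ-instantiation, p456024 local transversality, p456201 local
unramifiedness).  HONEST FRAMING: helper; closes nothing; the INPUT cocycle `y` (Kato's `𝐳̄_q`
modulo `T^J` on `Gal(ℚ̄/ℚ(μ_ℓ))`, with vanishing norm and Kato integrality) is NOT produced here —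
that is the open upstream «G3a» (relative Shapiro of the genuine `IsEulerSystemClass`).
PARTITION (D-0054): X9 (A4) · X10b (A5) — helper; closes NONE.

* `natCast_primesEquiv_not_mem_of_ne` — `w ≠ q ⟹ (ℓ : 𝓞 ℚ) ∉ w` (`ℓ` the prime of `q`), so
  `Gal(ℚ̄/ℚ(μ_ℓ))` is unramified at `w` (`rootsOfUnityFixer_unramifiedAt_of_not_mem`);
* **`exists_kolyvaginCocycle_meetingPoint`** — from `y` (unramified at every `𝔓 ∤ p` in the shape of
  `Kato2004.integralH1`, vanishing norm `res (cor [y]) = 0`), the data `(σ, τq, Φ)`: `σ ∈ ℐ_{𝔓₀}` a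
  tame generator (`𝔓₀ = adicCompletionPrime ℚ q`), `τq ∈ I_{ℚ_q}` with `res τq = σ`, `Φ` the
  Kolyvagin cocycle with `Φ|_N = Σ i•σ^i·y`, the value clause `Φ(res τq) = Φ(σ) = −a` for every norm
  witness `a`, `res[Φ] = D[y]` (unique), **`hx`**: `loc_w [Φ] ∈ H¹_ur(ℚ_w)` for every `w ≠ q` with
  `w ∤ p` and `ρ` unramified at `w`, and **`loc_q [Φ] ∈ H¹_tr(ℚ_q)`** (`CyclotomicField ℓ ℚ_q`).

References: HOME/koly/MU-TRANSFER-PROOF.md §3 Lemma 2, §5 STEP 3; K. Rubin, *Euler Systems*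
(2000) §4.4–4.5 [Rubin2000]; B. Perrin-Riou, Ann. Inst. Fourier 48 (1998) §3.1.2 [PerrinRiou1998AIF].
-/

-- the summit and its single problem are both named `BirchSwinnertonDyer` (registry layout D-0017)
set_option linter.dupNamespace false
set_option autoImplicit false

noncomputable section

open CategoryTheory Function Finset
open scoped NumberField Pointwise
open Field IsDedekindDomain NumberField
open Literature.NumberTheory.GaloisRepresentations
open Literature.NumberTheory.GaloisRepresentations.IsNonarchimedeanLocalField
open Literature.NumberTheory.EllipticCurves
open Literature.NumberTheory.EllipticCurves.ZpExtension
open Rat.HeightOneSpectrum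
open Summit.BirchSwinnertonDyer.Rank1Residual.GaloisImage

namespace Summit.BirchSwinnertonDyer.BirchSwinnertonDyer.Rank1Residual.KolyvaginTwist

/-- **`w ≠ q ⟹ (ℓ : 𝓞 ℚ) ∉ w`** for the rational prime `ℓ` of the place `q` (distinct places of
`ℚ` have distinct primes); hence `Gal(ℚ̄/ℚ(μ_ℓ))` is unramified at `w`
(`rootsOfUnityFixer_unramifiedAt_of_not_mem`). [cite: Rubin2000, Thm. 4.5.1] -/
theorem natCast_primesEquiv_not_mem_of_ne {q w : HeightOneSpectrum (𝓞 ℚ)} (hw : w ≠ q) :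
    ((((primesEquiv q : Nat.Primes) : ℕ) : ℕ) : 𝓞 ℚ) ∉ w.asIdeal := by
  refine Rat.natCast_not_mem_asIdeal_of_not_dvd fun h => hw ?_
  have h' : ((primesEquiv w : Nat.Primes) : ℕ) = (primesEquiv q : Nat.Primes) :=
    (Nat.prime_dvd_prime_iff_eq (primesEquiv w).2 (primesEquiv q).2).mp h
  exact primesEquiv.injective (Subtype.ext h')

variable {p : ℕ} [Fact p.Prime] {M : Type} [AddCommGroup M] [TopologicalSpace M]
  [DiscreteTopology M] (κ : ZpExtension ℚ p) (ρ : DiscreteGaloisModule ℚ M)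
  (hM : ∀ m : M, p • m = 0) (J : ℕ)

/-- **The Kolyvagin cocycle at the G3/G4 meeting point** (MU-TRANSFER-PROOF §3 Lemma 2 + §5
STEP 3, minus the production of `y` and the division step).  Data: `p` odd; `κ`, `ρ` (`p·M = 0`,
`M^{Gal(ℚ̄/ℚ(μ_ℓ))} = 0`), `𝒯_J = κ.twistModP ρ hM J`; the Chebotarev place `q` (prime `ℓ ≠ p`,
`ρ` unramified at `q`, `p ∣ ℓ − 1`); an `N`-cocycle `y` in `𝒯_J`, `N = Gal(ℚ̄/ℚ(μ_ℓ))`, that is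
UNRAMIFIED AT EVERY PRIME `𝔓 ∤ p` (`Kato2004.integralH1` shape) and has VANISHING NORM.  Output:
a tame generator `σ ∈ ℐ_{𝔓₀}` (`𝔓₀ = adicCompletionPrime ℚ q`), a LOCAL inertia element
`τq ∈ I_{ℚ_q}` with `res τq = σ`, and the Kolyvagin cocycle `Φ` with: `Φ|_N = Σ_{i<ℓ−1} i•σ^i·y`;
a norm witness exists and `Φ(res τq) = Φ(σ) = −a` for every norm witness `a`; `res[Φ] = D[y]`,
uniquely; **`hx`**: `loc_w [Φ] ∈ H¹_ur(ℚ_w, 𝒯_J)` for all `w ≠ q`, `w ∤ p`, `ρ` unramified at `w`;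
**`loc_q [Φ] ∈ H¹_tr(ℚ_q, 𝒯_J)`** w.r.t. `ℚ_q(μ_ℓ)`.  These are the hypotheses `c`, `hx`,
`[c] ∈ H¹_tr`, `c.1 (res τq)` of x10's `StepFour.convCoeff_eq_zero_of_qTermIdentity`.
[cite: Rubin2000, Def. 4.4.4, Lemma 4.4.2 and Thm. 4.5.1] [cite: PerrinRiou1998AIF, §3.1.2] -/
theorem exists_kolyvaginCocycle_meetingPoint (hp2 : p ≠ 2) (q : HeightOneSpectrum (𝓞 ℚ))
    [NeZero ((primesEquiv q : Nat.Primes) : ℕ)] [Fact (((primesEquiv q : Nat.Primes) : ℕ)).Prime]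
    [NeZero ((((primesEquiv q : Nat.Primes) : ℕ) : ℕ) : q.adicCompletion ℚ)]
    [hNn : (rootsOfUnityFixer ℚ ((primesEquiv q : Nat.Primes) : ℕ)).Normal]
    [Fintype (absoluteGaloisGroup ℚ ⧸ rootsOfUnityFixer ℚ ((primesEquiv q : Nat.Primes) : ℕ))]
    (hfix : ∀ m : M,
      (∀ g ∈ rootsOfUnityFixer ℚ ((primesEquiv q : Nat.Primes) : ℕ), ρ g m = m) → m = 0)
    (hpq : (p : 𝓞 ℚ) ∉ q.asIdeal) (hunr : GaloisRep.IsUnramifiedAt q ρ)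
    (hdvd : p ∣ ((primesEquiv q : Nat.Primes) : ℕ) - 1)
    (y : contOneCocycles (subgroupRep (κ.twistModP ρ hM J).toTopRep
      (rootsOfUnityFixer ℚ ((primesEquiv q : Nat.Primes) : ℕ))))
    (hyI : ∀ w : HeightOneSpectrum (𝓞 ℚ), (p : 𝓞 ℚ) ∉ w.asIdeal → ∀ 𝔓 ∈ w.primesAbove,
      resLe (κ.twistModP ρ hM J).toTopRep
        (inf_le_left : rootsOfUnityFixer ℚ ((primesEquiv q : Nat.Primes) : ℕ) ⊓
          𝔓.inertia (absoluteGaloisGroup ℚ) ≤ _) 1 (oneCocycleClass _ y) = 0)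
    (h𝒩 : resSubgroup (κ.twistModP ρ hM J).toTopRep
        (rootsOfUnityFixer ℚ ((primesEquiv q : Nat.Primes) : ℕ)) 1
      (cores (κ.twistModP ρ hM J).toTopRep (rootsOfUnityFixer ℚ ((primesEquiv q : Nat.Primes) : ℕ))
        (isOpen_rootsOfUnityFixer ℚ _) (oneCocycleClass _ y)) = 0) :
    ∃ σ ∈ (adicCompletionPrime ℚ q).inertia (absoluteGaloisGroup ℚ),
      ∃ τq ∈ absInertia (q.adicCompletion ℚ),
      absGaloisRestrict ℚ (q.adicCompletion ℚ) τq = σ ∧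
      σ ^ (((primesEquiv q : Nat.Primes) : ℕ) - 1) ∈
          rootsOfUnityFixer ℚ ((primesEquiv q : Nat.Primes) : ℕ) ∧
      (∀ x : Fin J → M, κ.twistModP ρ hM J σ x = x) ∧
      ∃ Φ : contOneCocycles (κ.twistModP ρ hM J).toTopRep,
        (∀ u : rootsOfUnityFixer ℚ ((primesEquiv q : Nat.Primes) : ℕ),
          Φ.1 u = ∑ i ∈ range (((primesEquiv q : Nat.Primes) : ℕ) - 1),
            (i : ℤ) • (κ.twistModP ρ hM J).toTopRep.ρ (σ ^ i) (y.1 (subgroupConj _ (σ ^ i) u))) ∧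
        (∃ a : Fin J → M, ∀ u : rootsOfUnityFixer ℚ ((primesEquiv q : Nat.Primes) : ℕ),
          ∑ i ∈ range (((primesEquiv q : Nat.Primes) : ℕ) - 1),
            (κ.twistModP ρ hM J).toTopRep.ρ (σ ^ i) (y.1 (subgroupConj _ (σ ^ i) u)) =
            (κ.twistModP ρ hM J).toTopRep.ρ (u : absoluteGaloisGroup ℚ) a - a) ∧
        (∀ a : Fin J → M, (∀ u : rootsOfUnityFixer ℚ ((primesEquiv q : Nat.Primes) : ℕ),
          ∑ i ∈ range (((primesEquiv q : Nat.Primes) : ℕ) - 1),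
            (κ.twistModP ρ hM J).toTopRep.ρ (σ ^ i) (y.1 (subgroupConj _ (σ ^ i) u)) =
            (κ.twistModP ρ hM J).toTopRep.ρ (u : absoluteGaloisGroup ℚ) a - a) →
          Φ.1 (absGaloisRestrict ℚ (q.adicCompletion ℚ) τq) = -a) ∧
        resSubgroup (κ.twistModP ρ hM J).toTopRep
            (rootsOfUnityFixer ℚ ((primesEquiv q : Nat.Primes) : ℕ)) 1 (oneCocycleClass _ Φ) =
          ∑ i ∈ range (((primesEquiv q : Nat.Primes) : ℕ) - 1),
            i • conjMap (κ.twistModP ρ hM J).toTopRep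
              (rootsOfUnityFixer ℚ ((primesEquiv q : Nat.Primes) : ℕ)) (σ ^ i) 1 (oneCocycleClass _ y) ∧
        (∀ κ' : continuousCohomology 1 (κ.twistModP ρ hM J).toTopRep,
          resSubgroup (κ.twistModP ρ hM J).toTopRep
              (rootsOfUnityFixer ℚ ((primesEquiv q : Nat.Primes) : ℕ)) 1 κ' =
            ∑ i ∈ range (((primesEquiv q : Nat.Primes) : ℕ) - 1),
              i • conjMap (κ.twistModP ρ hM J).toTopRep
                (rootsOfUnityFixer ℚ ((primesEquiv q : Nat.Primes) : ℕ)) (σ ^ i) 1 (oneCocycleClass _ y) →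
          κ' = oneCocycleClass _ Φ) ∧
        (∀ w : HeightOneSpectrum (𝓞 ℚ), w ≠ q → (p : 𝓞 ℚ) ∉ w.asIdeal →
          GaloisRep.IsUnramifiedAt w ρ →
          galoisCohomology.localization (κ.twistModP ρ hM J) (Sum.inr w) 1 (oneCocycleClass _ Φ) ∈
            DiscreteGaloisModule.unramifiedSubgroup (GaloisRep.toLocal w (κ.twistModP ρ hM J)) 1) ∧
        galoisCohomology.localization (κ.twistModP ρ hM J) (Sum.inr q) 1 (oneCocycleClass _ Φ) ∈
          DiscreteGaloisModule.transverseSubgroup (GaloisRep.toLocal q (κ.twistModP ρ hM J))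
            (CyclotomicField ((primesEquiv q : Nat.Primes) : ℕ) (q.adicCompletion ℚ)) := by
  obtain ⟨σ, hσI, hσn, hcov, hσ, Φ, hΦN, hwit, hval, hres, huniq, -, hnorm⟩ :=
    exists_kolyvaginCocycle_rat κ ρ hM J hp2 q hfix hpq hunr hdvd
      (adicCompletionPrime_mem_primesAbove ℚ q) y
      (hyI q hpq _ (adicCompletionPrime_mem_primesAbove ℚ q)) h𝒩
  -- a local inertia element over `σ`
  have hσ' : σ ∈ (absInertia (q.adicCompletion ℚ)).map
      (absGaloisRestrict ℚ (q.adicCompletion ℚ)).toMonoidHom := by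
    rw [← inertia_adicCompletionPrime_eq_map_absInertia]; exact hσI
  obtain ⟨τq, hτq, hτqσ⟩ := Subgroup.mem_map.mp hσ'
  refine ⟨σ, hσI, τq, hτq, hτqσ, hσn, hσ, Φ, hΦN, hwit, fun a ha => ?_, hres, huniq,
    fun w hwq hwp hwunr => ?_, ?_⟩
  · -- the value clause at `res τq = σ`
    change Φ.1 ((absGaloisRestrict ℚ (q.adicCompletion ℚ)).toMonoidHom τq) = -a
    rw [hτqσ]
    exact hval a ha
  · -- `hx`: unramified at `w ≠ q`, `w ∤ p`
    have hwN : ∀ 𝔓 ∈ w.primesAbove, 𝔓.inertia (absoluteGaloisGroup ℚ) ≤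
        rootsOfUnityFixer ℚ ((primesEquiv q : Nat.Primes) : ℕ) :=
      rootsOfUnityFixer_unramifiedAt_of_not_mem ℚ _ (natCast_primesEquiv_not_mem_of_ne hwq)
    have hX : ∀ 𝔓 ∈ w.primesAbove, ∀ τ ∈ 𝔓.inertia (absoluteGaloisGroup ℚ),
        ∀ x : (κ.twistModP ρ hM J).toTopRep, (κ.twistModP ρ hM J).toTopRep.ρ τ x = x :=
      fun 𝔓 h𝔓 τ hτ x => twistModP_apply_eq_self_of_mem_inertia κ ρ hM J hwp hwunr h𝔓 hτ x
    have hy := forall_primesAbove_apply_eq_zero_of_resLe_inf_eq_zero _ _ hwN hX y (hyI w hwp)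
    exact localization_mem_unramifiedSubgroup_of_forall_inertia_apply_eq_zero (κ.twistModP ρ hM J) w Φ
      fun τ hτ => derivCocycle_apply_eq_zero_of_forall_primesAbove _ _ hwN σ _ y hy Φ hΦN
        (adicCompletionPrime_mem_primesAbove ℚ w) hτ
  · -- transverse at `q`
    exact localization_mem_transverseSubgroup_of_forall_apply_eq_zero (κ.twistModP ρ hM J) q _ Φ
      hnorm

end Summit.BirchSwinnertonDyer.BirchSwinnertonDyer.Rank1Residual.KolyvaginTwist

end
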